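import Summits.KontsevichZagierPeriods.KontsevichZagierPeriods.Theses.FurushoPentagon
import Literature.NumberTheory.Transcendental.DrinfeldAssociatorEdge
import Literature.NumberTheory.Transcendental.KZLogCalculusProofs

/-!
# `PentagonInKZ` — stub `stub_cornersCubical`: transport of end-regularised series along a
letter map (aux)

Bookkeeping for comparing the end-regularised generating series of two families of iterated
integrals whose letters correspond under a map of alphabets `L → ι` (live letters of a corner
chart) and `L → κ` (letters of an atlas path): dead letters (density `0`) contribute nothing,
live letters are identified word by word by congruence of representations
(`KZ.of_sub_of_mem_relations_of_eqOn`), merged letters add their residues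
(`evalTrunc_letterMap`).
-/

noncomputable section

open Literature.NumberTheory.Transcendental

namespace Summit.KontsevichZagierPeriods.FurushoPentagon.PentagonInKZ

namespace CornersCubical

/-! ### Letter maps on truncated evaluations and on end regularisations -/

/-- **Letter substitution under a map of alphabets**: evaluating `W ↦ S(φ W)` at `v` is evaluating
`S` at the fibre sums `b ↦ Σ_{φ a = b} v a`. [folklore] -/
theorem evalTrunc_letterMap' {R : Type} [CommRing R] {A : Type} [Ring A] [Algebra R A]
    {ι κ : Type} [Fintype ι] [DecidableEq ι] [Fintype κ] [DecidableEq κ] (φ : ι → κ)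
    (S : NCSeries κ R) (v : ι → A) (N : ℕ) :
    NCSeries.evalTrunc N v (fun W : List ι => S (W.map φ)) =
      NCSeries.evalTrunc N
        (fun b : κ => ∑ a ∈ Finset.univ.filter (fun a : ι => φ a = b), v a) S := by
  unfold NCSeries.evalTrunc
  refine Finset.sum_congr rfl fun n _ => ?_
  simp only [List.map_ofFn]
  -- product of fibre sums, expanded by multilinearity of `m ↦ (List.ofFn m).prod`
  have hprod : ∀ g : Fin n → κ,
      (List.ofFn ((fun b : κ => ∑ a ∈ Finset.univ.filter (fun a : ι => φ a = b), v a) ∘ g)).prod =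
        ∑ f ∈ Fintype.piFinset (fun i => Finset.univ.filter fun a : ι => φ a = g i),
          (List.ofFn (v ∘ f)).prod := by
    intro g
    have h := (MultilinearMap.mkPiAlgebraFin R n A).map_sum_finset (fun _ (a : ι) => v a)
      (fun i => Finset.univ.filter fun a : ι => φ a = g i)
    simpa only [MultilinearMap.mkPiAlgebraFin_apply, Function.comp_def] using h
  have hpi : ∀ g : Fin n → κ,
      Fintype.piFinset (fun i => Finset.univ.filter fun a : ι => φ a = g i) =
        Finset.univ.filter fun f : Fin n → ι => φ ∘ f = g := by
    intro g
    ext f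
    simp only [Fintype.mem_piFinset, Finset.mem_filter, Finset.mem_univ, true_and,
      funext_iff, Function.comp_apply]
  symm
  calc ∑ g : Fin n → κ, S (List.ofFn g) •
        (List.ofFn ((fun b : κ => ∑ a ∈ Finset.univ.filter (fun a : ι => φ a = b), v a) ∘ g)).prod
      = ∑ g : Fin n → κ,
          ∑ f ∈ Fintype.piFinset (fun i => Finset.univ.filter fun a : ι => φ a = g i),
          S (List.ofFn g) • (List.ofFn (v ∘ f)).prod := by
        refine Finset.sum_congr rfl fun g _ => ?_
        rw [hprod, Finset.smul_sum]
    _ = ∑ g : Fin n → κ, ∑ f : Fin n → ι,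
          (if φ ∘ f = g then S (List.ofFn g) • (List.ofFn (v ∘ f)).prod else 0) := by
        refine Finset.sum_congr rfl fun g _ => ?_
        rw [hpi g, Finset.sum_filter]
    _ = ∑ f : Fin n → ι, ∑ g : Fin n → κ,
          (if φ ∘ f = g then S (List.ofFn g) • (List.ofFn (v ∘ f)).prod else 0) := Finset.sum_comm
    _ = ∑ f : Fin n → ι, S (List.ofFn (φ ∘ f)) • (List.ofFn (v ∘ f)).prod := by
        refine Finset.sum_congr rfl fun f _ => ?_
        rw [Finset.sum_ite_eq, if_pos (Finset.mem_univ _)]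

/-- The number of leading `y`'s is invariant under a change of alphabet injective over `φ y`.
[folklore] -/
theorem leadCount_map_of_fibre {ι κ : Type} [DecidableEq ι] [DecidableEq κ] (φ : ι → κ) (y : ι)
    (hφ : ∀ a, φ a = φ y → a = y) (w : List ι) :
    Shuffle.leadCount (φ y) (w.map φ) = Shuffle.leadCount y w := by
  unfold Shuffle.leadCount
  rw [List.takeWhile_map, List.length_map]
  congr 2
  funext b
  simp only [Function.comp_apply]
  by_cases hb : b = y
  · simp [hb]
  · have hb' : φ b ≠ φ y := fun h => hb (hφ b h)
    simp [hb, hb']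

/-- `reg^{φ y}(φ w) = φ_* reg^y(w)` for a change of alphabet injective over `φ y`. [folklore] -/
theorem regFront_map_of_fibre {ι κ : Type} [DecidableEq ι] [DecidableEq κ] (φ : ι → κ) (y : ι)
    (hφ : ∀ a, φ a = φ y → a = y) (w : List ι) :
    Shuffle.regFront (φ y) (w.map φ) = (Shuffle.regFront y w).mapDomain (List.map φ) := by
  unfold Shuffle.regFront
  rw [leadCount_map_of_fibre φ y hφ, Finsupp.mapDomain_finsetSum]
  refine Finset.sum_congr rfl fun i _ => ?_
  rw [Finsupp.mapDomain_smul, ← Shuffle.shuffleSum_map, List.map_replicate, List.map_drop]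

/-- **`reg_{φ x}(φ W) = φ_* reg_x(W)`** for a change of alphabet `φ` with `φ⁻¹(φ x) = {x}` (not
necessarily injective elsewhere: letters with equal densities may merge). [folklore] -/
theorem regEnd_map_of_fibre {ι κ : Type} [DecidableEq ι] [DecidableEq κ] (φ : ι → κ) (x : ι)
    (hφ : ∀ a, φ a = φ x → a = x) (W : List ι) :
    Shuffle.regEnd (φ x) (W.map φ) = (Shuffle.regEnd x W).mapDomain (List.map φ) := by
  unfold Shuffle.regEnd
  rw [← List.map_reverse, regFront_map_of_fibre φ x hφ, ← Finsupp.mapDomain_comp,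
    ← Finsupp.mapDomain_comp]
  congr 1
  funext v
  simp [List.map_reverse]

/-! ### Classes of representations -/

/-- A representation whose (product) integrand has a letter of density `0` on the side is a
relation, so every realisation of the rules kills it. [folklore] -/
theorem chi_eq_zero_of_dead {R : Type} [AddCommGroup R] (χ : KZ.FormalRep →+ R)
    (hrel : ∀ c ∈ KZ.relations, χ c = 0) {ι : Type} (β : ℝ) (dens : ι → ℝ → ℝ)
    {u : List ι} (I : KZ.IntegralRep u.length)
    (hI : I.domain = {t | (∀ i, 0 < t i ∧ t i < β) ∧ StrictAnti t} ∧
      Set.EqOn I.integrand (fun t => ∏ i, dens (u.get i) (t i)) I.domain)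
    {a : ι} (hau : a ∈ u) (hdead : ∀ s, 0 < s → s < β → dens a s = 0) : χ (KZ.of I) = 0 := by
  refine hrel _ (KZ.of_mem_relations_of_eqOn_zero I fun t ht => ?_)
  rw [hI.2 ht]
  obtain ⟨j, hj⟩ := List.mem_iff_get.mp hau
  rw [hI.1] at ht
  exact Finset.prod_eq_zero (Finset.mem_univ j) (by rw [hj]; exact hdead _ (ht.1 j).1 (ht.1 j).2)

/-- **Congruence of product representations of possibly different (but equal) dimensions**: two
representations over the simplices of side `β` whose letter densities agree factor by factor on
`(0, β)` have the same class modulo relations. [folklore] -/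
theorem of_sub_of_mem_relations_of_shape {n n' : ℕ} (h : n = n') (r : KZ.IntegralRep n)
    (r' : KZ.IntegralRep n') (β : ℝ) (d : Fin n → ℝ → ℝ) (d' : Fin n' → ℝ → ℝ)
    (hr : r.domain = {t | (∀ i, 0 < t i ∧ t i < β) ∧ StrictAnti t} ∧
      Set.EqOn r.integrand (fun t => ∏ i, d i (t i)) r.domain)
    (hr' : r'.domain = {t | (∀ i, 0 < t i ∧ t i < β) ∧ StrictAnti t} ∧
      Set.EqOn r'.integrand (fun t => ∏ i, d' i (t i)) r'.domain)
    (hdd' : ∀ i : Fin n, ∀ s, 0 < s → s < β → d i s = d' (Fin.cast h i) s) :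
    KZ.of r - KZ.of r' ∈ KZ.relations := by
  subst h
  refine KZ.of_sub_of_mem_relations_of_eqOn (hr'.1.trans hr.1.symm) fun t ht => ?_
  have ht' : t ∈ r'.domain := by rw [hr'.1]; rw [hr.1] at ht; exact ht
  rw [hr.2 ht, hr'.2 ht']
  rw [hr.1] at ht
  exact Finset.prod_congr rfl fun i _ => by
    simpa using hdd' i (t i) (ht.1 i).1 (ht.1 i).2

/-! ### The side transport -/

section Side

variable {R : Type} [CommRing R] [Algebra ℚ R] {A : Type} [Ring A] [Algebra R A]
  (χ : KZ.FormalRep →+ R) (hrel : ∀ c ∈ KZ.relations, χ c = 0)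
  {ι κ L : Type} [Fintype ι] [DecidableEq ι] [Fintype κ] [DecidableEq κ] [Fintype L]
  [DecidableEq L]
  (β : ℝ) (dens : ι → ℝ → ℝ) (σ : κ → ℝ) (x : ι) (y : κ)
  (Im : (w : List ι) → KZ.IntegralRep w.length)
  (hIm : ∀ w : List ι, w.getLast? ≠ some x →
    (Im w).domain = {t | (∀ i, 0 < t i ∧ t i < β) ∧ StrictAnti t} ∧
    Set.EqOn (Im w).integrand (fun t => ∏ i, dens (w.get i) (t i)) (Im w).domain)
  (Ia : (w : List κ) → KZ.IntegralRep w.length)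
  (hIa : ∀ w : List κ, w.getLast? ≠ some y →
    (Ia w).domain = {t | (∀ i, 0 < t i ∧ t i < β) ∧ StrictAnti t} ∧
    Set.EqOn (Ia w).integrand (fun t => ∏ i, 1 / (t i - σ (w.get i))) (Ia w).domain)
  (incl : L → ι) (hincl : Function.Injective incl) (φ : L → κ) (xL : L) (hx : incl xL = x)
  (hy : ∀ a, φ a = y ↔ a = xL)
  (hdens : ∀ i : ι, (∃ a, incl a = i) ∨ ∀ s, 0 < s → s < β → dens i s = 0)
  (hlive : ∀ (a : L) (s : ℝ), 0 < s → s < β → dens (incl a) s = 1 / (s - σ (φ a)))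

include hrel hIm hIa hincl hx hy hlive in
omit [Algebra ℚ R] [Fintype ι] [DecidableEq ι] [Fintype κ] [DecidableEq κ] [Fintype L]
  [DecidableEq L] in
/-- **Word-by-word identification of the live classes**: for a word `u` over the live letters not
ending in the regularised letter, the chart representation at `incl u` and the atlas
representation at `φ u` have the same realisation. [folklore] -/
theorem chi_live_eq (u : List L) (hu : u.getLast? ≠ some xL) :
    χ (KZ.of (Im (u.map incl))) = χ (KZ.of (Ia (u.map φ))) := by
  have h1 : (u.map incl).getLast? ≠ some x := by
    rw [List.getLast?_map]
    cases h : u.getLast? with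
    | none => simp
    | some a =>
      simp only [Option.map_some, ne_eq, Option.some.injEq]
      intro ha
      exact hu (by rw [h, hincl (ha.trans hx.symm)])
  have h2 : (u.map φ).getLast? ≠ some y := by
    rw [List.getLast?_map]
    cases h : u.getLast? with
    | none => simp
    | some a =>
      simp only [Option.map_some, ne_eq, Option.some.injEq]
      intro ha
      exact hu (by rw [h, (hy a).mp ha])
  have hsub := of_sub_of_mem_relations_of_shape (by simp) (Im (u.map incl)) (Ia (u.map φ)) β
    (fun i s => dens ((u.map incl).get i) s) (fun i s => 1 / (s - σ ((u.map φ).get i)))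
    (hIm _ h1) (hIa _ h2) (fun i s hs0 hs1 => by
      simp only [List.get_eq_getElem, List.getElem_map, Fin.val_cast]
      exact hlive _ s hs0 hs1)
  have := hrel _ hsub
  rwa [map_sub, sub_eq_zero] at this

include hrel hIm hIa hincl hx hy hlive in
omit [Fintype ι] [Fintype κ] [Fintype L] in
/-- **The series agree on live words**: `Pm (incl W) = Pa (φ W)`. [folklore] -/
theorem series_live_eq (Pm : NCSeries ι R)
    (hPm : ∀ W, Pm W = if W = [] then 1 else
      Shuffle.pair (fun w => χ (KZ.of (Im w))) (Shuffle.regEnd x W))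
    (Pa : NCSeries κ R)
    (hPa : ∀ W, Pa W = if W = [] then 1 else
      Shuffle.pair (fun w => χ (KZ.of (Ia w))) (Shuffle.regEnd y W))
    (W : List L) : Pm (W.map incl) = Pa (W.map φ) := by
  rw [hPm, hPa]
  by_cases hW : W = []
  · simp [hW]
  have hyx : y = φ xL := ((hy xL).mpr rfl).symm
  have e1 : Shuffle.regEnd x (W.map incl) = (Shuffle.regEnd xL W).mapDomain (List.map incl) := by
    rw [← hx]
    exact regEnd_map_of_fibre incl xL (fun a h => hincl h) W
  have e2 : Shuffle.regEnd y (W.map φ) = (Shuffle.regEnd xL W).mapDomain (List.map φ) := by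
    rw [hyx]
    exact regEnd_map_of_fibre φ xL (fun a h => (hy a).mp (h.trans hyx.symm)) W
  rw [if_neg (by simpa using hW), if_neg (by simpa using hW), e1, e2, Shuffle.pair_mapDomain₂,
    Shuffle.pair_mapDomain₂]
  refine Shuffle.pair_congr fun u hu => ?_
  simp only [Function.comp_apply]
  exact chi_live_eq χ hrel β dens σ x y Im hIm Ia hIa incl hincl φ xL hx hy hlive u
    (Shuffle.getLast?_ne_of_mem_support_regEnd xL W hu)

include hrel hIm hdens in
omit [Fintype ι] [Fintype L] [DecidableEq L] in
/-- **Dead words vanish**: a nonempty word containing a letter of density `0` has end-regularised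
coefficient `0` (the regularisation preserves letter counts). [folklore] -/
theorem series_dead_eq_zero (Pm : NCSeries ι R)
    (hPm : ∀ W, Pm W = if W = [] then 1 else
      Shuffle.pair (fun w => χ (KZ.of (Im w))) (Shuffle.regEnd x W))
    {W : List ι} {i : ι} (hiW : i ∈ W) (hi : ∀ a, incl a ≠ i) : Pm W = 0 := by
  have hW : W ≠ [] := List.ne_nil_of_mem hiW
  rw [hPm, if_neg hW]
  have hdead : ∀ s, 0 < s → s < β → dens i s = 0 := by
    rcases hdens i with ⟨a, ha⟩ | h
    · exact absurd ha (hi a)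
    · exact h
  rw [Shuffle.pair_congr (χ' := fun _ => (0 : R)) fun u hu => ?_]
  · simp [Shuffle.pair]
  have hu' := Shuffle.getLast?_ne_of_mem_support_regEnd x W hu
  have hiu : i ∈ u := by
    rw [← List.count_pos_iff, Shuffle.count_eq_of_mem_support_regEnd x W hu i, List.count_pos_iff]
    exact hiW
  exact chi_eq_zero_of_dead χ hrel β dens (Im u) (hIm u hu') hiu hdead

include hrel hIm hIa hincl hx hy hdens hlive in
/-- **The side transport**: the end-regularised generating series of a side of a corner chart,
evaluated at the residues `v`, equals the atlas series of the corresponding path evaluated at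
the merged residues `b ↦ Σ_{φ a = b} v (incl a)`. [cite: Drinfeld1991, §2] -/
theorem side_transport (Pm : NCSeries ι R)
    (hPm : ∀ W, Pm W = if W = [] then 1 else
      Shuffle.pair (fun w => χ (KZ.of (Im w))) (Shuffle.regEnd x W))
    (Pa : NCSeries κ R)
    (hPa : ∀ W, Pa W = if W = [] then 1 else
      Shuffle.pair (fun w => χ (KZ.of (Ia w))) (Shuffle.regEnd y W))
    (N : ℕ) (v : ι → A) (vκ : κ → A)
    (hv : ∀ b, vκ b = ∑ a ∈ Finset.univ.filter (fun a : L => φ a = b), v (incl a)) :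
    NCSeries.evalTrunc N v Pm = NCSeries.evalTrunc N vκ Pa := by
  -- restriction to the live sub-alphabet
  have h1 : NCSeries.evalTrunc N v Pm =
      NCSeries.evalTrunc N (v ∘ incl) (fun W : List L => Pm (W.map incl)) := by
    rw [evalTrunc_letterMap' incl Pm (v ∘ incl) N]
    unfold NCSeries.evalTrunc
    refine Finset.sum_congr rfl fun n _ => Finset.sum_congr rfl fun f _ => ?_
    by_cases hf : ∀ j, ∃ a, incl a = f j
    · congr 2
      refine List.map_congr_left fun i hi => ?_
      obtain ⟨j, rfl⟩ := List.mem_ofFn.mp hi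
      obtain ⟨a, ha⟩ := hf j
      rw [← ha, Finset.sum_eq_single a (fun b hb hba => ?_) (fun h => ?_)]
      · rfl
      · exact absurd (hincl (Finset.mem_filter.mp hb).2) hba
      · exact (h (Finset.mem_filter.mpr ⟨Finset.mem_univ a, rfl⟩)).elim
    · push Not at hf
      obtain ⟨j, hj⟩ := hf
      rw [series_dead_eq_zero χ hrel β dens x Im hIm incl hdens Pm hPm
        (List.mem_ofFn.mpr ⟨j, rfl⟩) hj, zero_smul, zero_smul]
  rw [h1]
  have h2 : (fun W : List L => Pm (W.map incl)) = fun W : List L => Pa (W.map φ) :=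
    funext (series_live_eq χ hrel β dens σ x y Im hIm Ia hIa incl hincl φ xL hx hy hlive Pm hPm
      Pa hPa)
  rw [h2, evalTrunc_letterMap' φ Pa (v ∘ incl) N]
  congr 1
  funext b
  rw [hv b]
  rfl

end Side


end CornersCubical

/-- **Sub-stub `cornersCubical_sideTransport` of `stub_cornersCubical`**: THE SIDE TRANSPORT —
the end-regularised generating series of a side of a corner chart (letters `ι`, regularised
letter `x`), evaluated at residues `v`, equals the series of an atlas path (letters `κ`,
regularised letter `y`) evaluated at the merged residues `b ↦ Σ_{φ a = b} v (incl a)`, for a live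
sub-alphabet `incl : L ↪ ι` with letter map `φ : L → κ` matching the densities, `φ⁻¹(y) = {x}`,
dead letters of density `0`. [cite: Drinfeld1991, §2] -/
theorem cornersCubical_sideTransport :
    ∀ (R : Type) [CommRing R] [Algebra ℚ R] (A : Type) [Ring A] [Algebra R A] (χ : KZ.FormalRep →+ R), (∀ c ∈ KZ.relations, χ c = 0) → ∀ (ι κ L : Type) [Fintype ι] [DecidableEq ι] [Fintype κ] [DecidableEq κ] [Fintype L] [DecidableEq L] (β : ℝ) (dens : ι → ℝ → ℝ) (σ : κ → ℝ) (x : ι) (y : κ) (Im : (w : List ι) → KZ.IntegralRep w.length), (∀ w : List ι, w.getLast? ≠ some x → (Im w).domain = {t | (∀ i, 0 < t i ∧ t i < β) ∧ StrictAnti t} ∧ Set.EqOn (Im w).integrand (fun t => ∏ i, dens (w.get i) (t i)) (Im w).domain) → ∀ (Ia : (w : List κ) → KZ.IntegralRep w.length), (∀ w : List κ, w.getLast? ≠ some y → (Ia w).domain = {t | (∀ i, 0 < t i ∧ t i < β) ∧ StrictAnti t} ∧ Set.EqOn (Ia w).integrand (fun t => ∏ i, 1 / (t i - σ (w.get i)))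 (Ia w).domain) → ∀ (incl : L → ι), Function.Injective incl → ∀ (φ : L → κ) (xL : L), incl xL = x → (∀ a, φ a = y ↔ a = xL) → (∀ i : ι, (∃ a, incl a = i) ∨ ∀ s : ℝ, 0 < s → s < β → dens i s = 0) → (∀ (a : L) (s : ℝ), 0 < s → s < β → dens (incl a) s = 1 / (s - σ (φ a))) → ∀ (Pm : NCSeries ι R), (∀ W, Pm W = if W = [] then 1 else Shuffle.pair (fun w => χ (KZ.of (Im w))) (Shuffle.regEnd x W)) → ∀ (Pa : NCSeries κ R), (∀ W, Pa W = if W = [] then 1 else Shuffle.pair (fun w => χ (KZ.of (Ia w))) (Shuffle.regEnd y W)) → ∀ (N : ℕ) (v : ι → A) (vκ : κ → A), (∀ b, vκ b = ∑ a ∈ Finset.univ.filter (fun a : L => φ a = b), v (incl a)) → NCSeries.evalTrunc N v Pm = NCSeries.evalTrunc N vκ Pa := by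
  intro R _ _ A _ _ χ hrel ι κ L _ _ _ _ _ _ β dens σ x y Im hIm Ia hIa incl hincl φ xL hx hy hdens
    hlive Pm hPm Pa hPa N v vκ hv
  exact CornersCubical.side_transport χ hrel β dens σ x y Im hIm Ia hIa incl hincl φ xL hx hy hdens
    hlive Pm hPm Pa hPa N v vκ hv

end Summit.KontsevichZagierPeriods.FurushoPentagon.PentagonInKZ
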